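import Summits.CriticalPhenomena.PercolationContinuityZ3.Theorems.Transplant.CayleySkeletonCustomers
import Summits.CriticalPhenomena.PercolationContinuityZ3.Theorems.Transplant.CayleyClassTwoUnitRange
import Mathlib.Data.ZMod.Basic
import HarnessLib

/-!
# `H₃(ℤ) × ℤ` with EVERY admissible generating system (no kernel letters required), and the virtually-Heisenberg torsion customer
# `Cay(H₃(ℤ) × ℤ/2; a, b, ab·e, ba·e)` — unconditional rows of the class-2 theorem

builds on p205010 (kernel theorem, internal audit signed; external expert review pending) — through the closed one-type `{±1}` node
(`CayleyNeg₂.theta_eq_zero_of_le`) and gen 13's `CylBase.boxWalks_of_classTwo` (file `CayleyClassTwoUnitRange`).  Lane `prim-bschramm`, seat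
`prim-bschramm-p4` gen 13 (PART C3 of `P4-GENERAL.md` §35.7/§35.10).  Helper file (`--supports stmt-CriticalPhenomena-4575 --as helper`).

* §1 `H3Z = H₃(ℤ) × ℤ` (gen 9's structure, chart `φ = (x, t)`, `ν = (−x, −y, c, −t)`): class 2 (`H3Z.lcs_two`, commutator formula
  `⁅g, h⁆ = (0, 0, g.x h.y − h.x g.y, 0)`), hence **`H3Z.theta_eq_zero_of_le_of_gens₂`: θ_g(p) = 0 ∀ p ≤ p_c on `Cay(H₃(ℤ) × ℤ; S)` for EVERY finite
  symmetric generating `S` with `ν(S) ⊆ S`, `|x|, |t| ≤ 1` on `S` and `a, t ∈ S`** — gen 9's `criticalContinuity_of_gens(_of_negNode₁)` needed the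
  kernel letters `b, c ∈ S` (and `κ` or N1); now neither: doubled and diagonal generators (`ab`, `bt`, `abt`, …) are allowed with nothing in the kernel.
* §2 `H3E = H₃(ℤ) × ℤ/2` on coordinates `(x, y, c, e)`, chart `φ = (x, y)`, `ν = (−x, −y, c, e)`, and the system `S₈ = {a, b, ab·e, ba·e}^±`:
  class 2, `ν(S₈) = S₈`, unit range with unit steps, generating — **`H3E.torsion_criticalContinuity`: θ_g(p_c) = 0 on `Cay(H₃(ℤ) × ℤ/2; S₈)`,
  unconditionally**.  This pair is reached ONLY through the class-2 theorem: every chart factors through `(x, y)` (torsion and commutators die), the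
  letter images are `(1,0), (0,1), (1,1), (1,1)`, so every chart has a diagonal or tall letter, and the letters-type core `{a, b}^±` does not generate
  (`H3E.core_ne_top`: it lies in the kernel of `g ↦ g.e`) — neither the kernel-letter criterion, nor `ofClassThree` + monotonicity, nor the
  basis-lifting 2-step row (`CayleyNilTwoAbstract`) applies.
[cite: BenjaminiSchramm1996, Conj. 4; §2 (Cayley graphs)] [cite: KozmaNitzan2024, §4 p. 16 (Lemma 8)]
-/

noncomputable section

namespace Summit.CriticalPhenomena.PercolationContinuityZ3.Theorems.Transplant

open MeasureTheory Literature.Probability.Percolation Literature.Probability.LatticeModels SimpleGraph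
open scoped Classical commutatorElement

/-! ## §1 `H₃(ℤ) × ℤ`: class 2 and every admissible generating system -/

namespace H3Z

/-- The commutator in coordinates: `⁅g, h⁆ = (0, 0, g.x h.y − h.x g.y, 0)`. [folklore] -/
theorem commutatorElement_eq (g h : H3Z) : ⁅g, h⁆ = ⟨0, 0, g.x * h.y - h.x * g.y, 0⟩ := by
  rw [commutatorElement_def]; (ext <;> simp); ring

/-- **`H₃(ℤ) × ℤ` has nilpotency class 2**: `γ₂ = ⁅⁅Γ,Γ⁆, Γ⁆ = 1` (commutators are central). [folklore] -/
theorem lcs_two : (⊤ : Subgroup H3Z).lowerCentralSeries 2 = ⊥ := by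
  rw [Subgroup.lowerCentralSeries_succ, Subgroup.commutator_eq_bot_iff_le_centralizer, Subgroup.lowerCentralSeries_succ,
    Subgroup.lowerCentralSeries_zero, Subgroup.commutator_le]
  intro g _ h _
  rw [Subgroup.mem_centralizer_iff]
  intro m _
  rw [commutatorElement_eq]
  ext <;> simp [add_comm]

/-- **THEOREM (UNCONDITIONAL; every admissible system, no kernel letters): `θ_g(p) = 0` for every `p ≤ p_c` at every vertex of
`Cay(H₃(ℤ) × ℤ; S)`** for every finite SYMMETRIC GENERATING `S` with `ν(S) ⊆ S`, `|x|, |t| ≤ 1` on `S` and `a, t ∈ S` — the other generators are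
arbitrary (`ab`, `bt`, `a b t c⁵`, …; no `b`, `c` required).  Via the class-2 connected-cylinder theorem and the closed `{±1}` node.
builds on p205010 (kernel theorem, internal audit signed; external expert review pending). [cite: BenjaminiSchramm1996, Conj. 4; §2] -/
theorem theta_eq_zero_of_le_of_gens₂ (S : Finset H3Z) (hν : ∀ s ∈ S, negAut s ∈ S) (hsymm : ∀ s ∈ S, s⁻¹ ∈ S)
    (hr : ∀ s ∈ S, |s.x| ≤ 1 ∧ |s.t| ≤ 1) (ha : gA ∈ S) (ht : gT ∈ S) (hgen : Subgroup.closure (S : Set H3Z) = ⊤) (g : H3Z)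
    {p : unitInterval} (hp : (p : ℝ) ≤ criticalProb (mulCayley (S : Set H3Z)) g) : theta (mulCayley (S : Set H3Z)) g p = 0 :=
  theta_eq_zero_of_le_classTwo lcs_two φ φ_mul (lip_of_range hr) (step_of_mem ha ht) hsymm hgen negAut
    (mem_iff_of_involutive negAut_negAut hν) φ_negAut g hp

/-- **`θ_g(p_c) = 0` on `Cay(H₃(ℤ) × ℤ; S)` for every admissible `S` as above** (the `p = p_c` case).
builds on p205010 (kernel theorem, internal audit signed; external expert review pending). [cite: BenjaminiSchramm1996, Conj. 4; §2] -/
theorem criticalContinuity_of_gens₂ (S : Finset H3Z) (hν : ∀ s ∈ S, negAut s ∈ S) (hsymm : ∀ s ∈ S, s⁻¹ ∈ S)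
    (hr : ∀ s ∈ S, |s.x| ≤ 1 ∧ |s.t| ≤ 1) (ha : gA ∈ S) (ht : gT ∈ S) (hgen : Subgroup.closure (S : Set H3Z) = ⊤) (g : H3Z) :
    theta (mulCayley (S : Set H3Z)) g (criticalProbIOf (mulCayley (S : Set H3Z)) g) = 0 :=
  theta_eq_zero_of_le_of_gens₂ S hν hsymm hr ha ht hgen g le_rfl

end H3Z

/-! ## §2 The torsion customer `H₃(ℤ) × ℤ/2` with `S₈ = {a, b, ab·e, ba·e}^±` -/

/-- **`H₃(ℤ) × ℤ/2`** on coordinates `(x, y, c, e)`: Heisenberg law on `(x, y, c)`, `e ∈ ℤ/2` central. [cite: BenjaminiSchramm1996, §2 (Cayley graphs)] -/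
@[ext] structure H3E where
  /-- abelianisation coordinate `x` -/
  x : ℤ
  /-- abelianisation coordinate `y` -/
  y : ℤ
  /-- central Heisenberg coordinate -/
  c : ℤ
  /-- the central involution coordinate -/
  e : ZMod 2
deriving DecidableEq

namespace H3E

/-- Multiplication `(x,y,c,e)·(x′,y′,c′,e′) = (x+x′, y+y′, c+c′+x y′, e+e′)`. [folklore] -/
instance : Mul H3E := ⟨fun g h => ⟨g.x + h.x, g.y + h.y, g.c + h.c + g.x * h.y, g.e + h.e⟩⟩

/-- The identity. [folklore] -/
instance : One H3E := ⟨⟨0, 0, 0, 0⟩⟩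

/-- Inversion `(x,y,c,e)⁻¹ = (−x, −y, −c + x y, −e)`. [folklore] -/
instance : Inv H3E := ⟨fun g => ⟨-g.x, -g.y, -g.c + g.x * g.y, -g.e⟩⟩

/-- `x` of a product. [folklore] -/
@[simp] theorem mul_x (g h : H3E) : (g * h).x = g.x + h.x := rfl
/-- `y` of a product. [folklore] -/
@[simp] theorem mul_y (g h : H3E) : (g * h).y = g.y + h.y := rfl
/-- `c` of a product. [folklore] -/
@[simp] theorem mul_c (g h : H3E) : (g * h).c = g.c + h.c + g.x * h.y := rfl
/-- `e` of a product. [folklore] -/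
@[simp] theorem mul_e (g h : H3E) : (g * h).e = g.e + h.e := rfl
/-- `x` of the identity. [folklore] -/
@[simp] theorem one_x : (1 : H3E).x = 0 := rfl
/-- `y` of the identity. [folklore] -/
@[simp] theorem one_y : (1 : H3E).y = 0 := rfl
/-- `c` of the identity. [folklore] -/
@[simp] theorem one_c : (1 : H3E).c = 0 := rfl
/-- `e` of the identity. [folklore] -/
@[simp] theorem one_e : (1 : H3E).e = 0 := rfl
/-- `x` of an inverse. [folklore] -/
@[simp] theorem inv_x (g : H3E) : g⁻¹.x = -g.x := rfl
/-- `y` of an inverse. [folklore] -/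
@[simp] theorem inv_y (g : H3E) : g⁻¹.y = -g.y := rfl
/-- `c` of an inverse. [folklore] -/
@[simp] theorem inv_c (g : H3E) : g⁻¹.c = -g.c + g.x * g.y := rfl
/-- `e` of an inverse. [folklore] -/
@[simp] theorem inv_e (g : H3E) : g⁻¹.e = -g.e := rfl

/-- **`H₃(ℤ) × ℤ/2` is a group.** [folklore] -/
instance : Group H3E where
  mul_assoc a b c := by ext <;> simp <;> ring
  one_mul a := by ext <;> simp
  mul_one a := by ext <;> simp
  inv_mul_cancel a := by ext <;> simp [-ZMod.neg_eq_self_mod_two]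

/-- Generator `a = (1,0,0,0)`. [folklore] -/
def gA : H3E := ⟨1, 0, 0, 0⟩
/-- Generator `b = (0,1,0,0)`. [folklore] -/
def gB : H3E := ⟨0, 1, 0, 0⟩
/-- Central `c = (0,0,1,0)` (`= ⁅a,b⁆`). [folklore] -/
def gC : H3E := ⟨0, 0, 1, 0⟩
/-- Central involution `e = (0,0,0,1)`. [folklore] -/
def gE : H3E := ⟨0, 0, 0, 1⟩

/-- Powers of `a`: `a^k = (k,0,0,0)`. [folklore] -/
theorem gA_zpow (k : ℤ) : (gA ^ k : H3E) = ⟨k, 0, 0, 0⟩ := by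
  induction k using Int.induction_on with
  | zero => rw [zpow_zero]; rfl
  | succ n ih => rw [zpow_add_one, ih]; ext <;> simp [gA]
  | pred n ih => rw [zpow_sub_one, ih]; (ext <;> simp [gA]); omega

/-- Powers of `b`: `b^k = (0,k,0,0)`. [folklore] -/
theorem gB_zpow (k : ℤ) : (gB ^ k : H3E) = ⟨0, k, 0, 0⟩ := by
  induction k using Int.induction_on with
  | zero => rw [zpow_zero]; rfl
  | succ n ih => rw [zpow_add_one, ih]; ext <;> simp [gB]
  | pred n ih => rw [zpow_sub_one, ih]; (ext <;> simp [gB]); omega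

/-- Powers of `c`: `c^k = (0,0,k,0)`. [folklore] -/
theorem gC_zpow (k : ℤ) : (gC ^ k : H3E) = ⟨0, 0, k, 0⟩ := by
  induction k using Int.induction_on with
  | zero => rw [zpow_zero]; rfl
  | succ n ih => rw [zpow_add_one, ih]; ext <;> simp [gC]
  | pred n ih => rw [zpow_sub_one, ih]; (ext <;> simp [gC]); omega

/-- The commutator in coordinates: `⁅g, h⁆ = (0, 0, g.x h.y − h.x g.y, 0)`. [folklore] -/
theorem commutatorElement_eq (g h : H3E) : ⁅g, h⁆ = ⟨0, 0, g.x * h.y - h.x * g.y, 0⟩ := by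
  rw [commutatorElement_def]; (ext <;> simp [-ZMod.neg_eq_self_mod_two]); ring

/-- **`H₃(ℤ) × ℤ/2` has nilpotency class 2.** [folklore] -/
theorem lcs_two : (⊤ : Subgroup H3E).lowerCentralSeries 2 = ⊥ := by
  rw [Subgroup.lowerCentralSeries_succ, Subgroup.commutator_eq_bot_iff_le_centralizer, Subgroup.lowerCentralSeries_succ,
    Subgroup.lowerCentralSeries_zero, Subgroup.commutator_le]
  intro g _ h _
  rw [Subgroup.mem_centralizer_iff]
  intro m _
  rw [commutatorElement_eq]
  ext <;> simp [add_comm]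

/-- **The reversing automorphism `ν = (−x, −y, c, e)`.** [cite: KozmaNitzan2024, §4 p. 16 (Lemma 8)] -/
def negAut : H3E ≃* H3E where
  toFun g := ⟨-g.x, -g.y, g.c, g.e⟩
  invFun g := ⟨-g.x, -g.y, g.c, g.e⟩
  left_inv g := by ext <;> simp
  right_inv g := by ext <;> simp
  map_mul' g h := by ext <;> simp <;> ring

/-- `ν` in coordinates. [folklore] -/
@[simp] theorem negAut_apply (g : H3E) : negAut g = ⟨-g.x, -g.y, g.c, g.e⟩ := rfl

/-- **The chart `φ = (x, y)`.** [cite: KozmaNitzan2024, §4 p. 15 (boxes)] -/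
def φ (g : H3E) : Site 2 := ![g.x, g.y]

/-- `φ` at `0`. [folklore] -/
@[simp] theorem φ_apply_zero (g : H3E) : φ g 0 = g.x := rfl
/-- `φ` at `1`. [folklore] -/
@[simp] theorem φ_apply_one (g : H3E) : φ g 1 = g.y := rfl

/-- `φ` is a homomorphism. [folklore] -/
theorem φ_mul (g h : H3E) : φ (g * h) = φ g + φ h := by
  funext j; fin_cases j <;> simp

/-- `φ ∘ ν = −φ`. [folklore] -/
theorem φ_negAut (g : H3E) : φ (negAut g) = -φ g := by
  funext j; fin_cases j <;> simp

/-- **`S₈ = {a, b, ab·e, ba·e}^±`**: `ab·e = (1,1,1,1)`, `ba·e = (1,1,0,1)`, inverses `(−1,−1,0,1)`, `(−1,−1,1,1)`.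
[cite: BenjaminiSchramm1996, §2 (Cayley graphs)] -/
def S₈ : Finset H3E :=
  {⟨1, 0, 0, 0⟩, ⟨-1, 0, 0, 0⟩, ⟨0, 1, 0, 0⟩, ⟨0, -1, 0, 0⟩, ⟨1, 1, 1, 1⟩, ⟨-1, -1, 0, 1⟩, ⟨1, 1, 0, 1⟩, ⟨-1, -1, 1, 1⟩}

/-- The elements of `S₈` are the letters and their inverses: `ab·e`, `(ab·e)⁻¹`, `ba·e`, `(ba·e)⁻¹`. [folklore] -/
theorem S₈_words : gA * gB * gE = ⟨1, 1, 1, 1⟩ ∧ (gA * gB * gE)⁻¹ = ⟨-1, -1, 0, 1⟩ ∧ gB * gA * gE = ⟨1, 1, 0, 1⟩ ∧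
    (gB * gA * gE)⁻¹ = ⟨-1, -1, 1, 1⟩ := by
  refine ⟨?_, ?_, ?_, ?_⟩ <;> decide

/-- `S₈` is symmetric. [folklore] -/
theorem S₈_symm : ∀ s ∈ S₈, s⁻¹ ∈ S₈ := by decide

/-- `ν` maps `S₈` into itself (`ν(ab·e) = (ba·e)⁻¹`, `ν(ba·e) = (ab·e)⁻¹`). [folklore] -/
theorem negAut_mem_S₈ : ∀ s ∈ S₈, negAut s ∈ S₈ := by
  intro s hs
  simp only [S₈, Finset.mem_insert, Finset.mem_singleton] at hs
  rcases hs with rfl | rfl | rfl | rfl | rfl | rfl | rfl | rfl <;> decide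

/-- `ν` preserves `S₈` exactly. [folklore] -/
theorem negAut_mem_S₈_iff (s : H3E) : negAut s ∈ S₈ ↔ s ∈ S₈ :=
  ⟨fun h => by
    have e : negAut (negAut s) = s := by ext <;> simp
    rw [← e]; exact negAut_mem_S₈ _ h, negAut_mem_S₈ s⟩

/-- Unit range of the chart on `S₈` (diagonal letters `(±1, ±1)`). [folklore] -/
theorem S₈_range : ∀ s ∈ S₈, ∀ i : Fin 2, |φ s i| ≤ 1 := by
  intro s hs i
  simp only [S₈, Finset.mem_insert, Finset.mem_singleton] at hs
  fin_cases i <;> rcases hs with rfl | rfl | rfl | rfl | rfl | rfl | rfl | rfl <;> decide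

/-- Unit steps in `S₈` (`a ↦ e₀`, `b ↦ e₁`). [folklore] -/
theorem S₈_step : ∀ i : Fin 2, ∃ s ∈ S₈, φ s = Pi.single i 1 := by
  intro i
  fin_cases i
  · exact ⟨gA, by decide, by funext j; fin_cases j <;> simp [gA]⟩
  · exact ⟨gB, by decide, by funext j; fin_cases j <;> simp [gB]⟩

/-- `S₈` generates `H₃(ℤ) × ℤ/2` (`e = (ab)⁻¹ · ab·e`, `c = ⁅a, b⁆`, `g = a^x b^y c^{c − xy} e^{e}`). [folklore] -/
theorem closure_S₈ : Subgroup.closure (S₈ : Set H3E) = ⊤ := by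
  rw [eq_top_iff]
  intro g _
  have ha : gA ∈ Subgroup.closure (S₈ : Set H3E) := Subgroup.subset_closure (by decide)
  have hb : gB ∈ Subgroup.closure (S₈ : Set H3E) := Subgroup.subset_closure (by decide)
  have habe : gA * gB * gE ∈ Subgroup.closure (S₈ : Set H3E) := by rw [S₈_words.1]; exact Subgroup.subset_closure (by decide)
  have he : gE ∈ Subgroup.closure (S₈ : Set H3E) := by
    have h : gE = (gA * gB)⁻¹ * (gA * gB * gE) := by group
    rw [h]; exact Subgroup.mul_mem _ (Subgroup.inv_mem _ (Subgroup.mul_mem _ ha hb)) habe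
  have hc : gC ∈ Subgroup.closure (S₈ : Set H3E) := by
    have h : gC = ⁅gA, gB⁆ := by rw [commutatorElement_eq]; decide
    rw [h, commutatorElement_def]
    exact Subgroup.mul_mem _ (Subgroup.mul_mem _ (Subgroup.mul_mem _ ha hb) (Subgroup.inv_mem _ ha)) (Subgroup.inv_mem _ hb)
  have hE : (⟨0, 0, 0, g.e⟩ : H3E) ∈ Subgroup.closure (S₈ : Set H3E) := by
    generalize g.e = ε
    fin_cases ε
    · exact (show (⟨0, 0, 0, 0⟩ : H3E) = 1 from rfl) ▸ Subgroup.one_mem _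
    · exact he
  have e : g = gA ^ g.x * gB ^ g.y * gC ^ (g.c - g.x * g.y) * ⟨0, 0, 0, g.e⟩ := by
    rw [gA_zpow, gB_zpow, gC_zpow]; ext <;> simp
  rw [e]
  exact Subgroup.mul_mem _ (Subgroup.mul_mem _ (Subgroup.mul_mem _ (Subgroup.zpow_mem _ ha _) (Subgroup.zpow_mem _ hb _))
    (Subgroup.zpow_mem _ hc _)) hE

/-- **The letters-type core `{a, b}^±` does NOT generate** (it lies in the kernel of the homomorphism `g ↦ g.e`, which `e` does not): no chart of
`(H₃(ℤ) × ℤ/2, S₈)` has a generating letters-type core. [folklore] -/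
theorem core_ne_top : Subgroup.closure ({gA, gA⁻¹, gB, gB⁻¹} : Set H3E) ≠ ⊤ := by
  intro h
  let ψ : H3E →* Multiplicative (ZMod 2) := MonoidHom.mk' (fun g => Multiplicative.ofAdd g.e) (fun g h => by simp [ofAdd_add])
  have hker : Subgroup.closure ({gA, gA⁻¹, gB, gB⁻¹} : Set H3E) ≤ ψ.ker := by
    rw [Subgroup.closure_le]
    intro s hs
    simp only [Set.mem_insert_iff, Set.mem_singleton_iff] at hs
    rcases hs with rfl | rfl | rfl | rfl <;> simp [ψ, MonoidHom.mem_ker, gA, gB]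
  have hE : gE ∈ ψ.ker := hker (by rw [h]; exact Subgroup.mem_top _)
  simp [ψ, MonoidHom.mem_ker, gE] at hE

/-- **The `CayleyNeg₂` of `(H₃(ℤ) × ℤ/2, S₈)`** — by the class-2 theorem (no kernel letters in `S₈`). [cite: KozmaNitzan2024, §4 p. 16 (Lemma 8)] -/
def torsion : CayleyNeg₂ H3E S₈ :=
  CayleyNeg₂.ofClassTwo lcs_two φ φ_mul S₈_range S₈_step S₈_symm closure_S₈ negAut negAut_mem_S₈_iff φ_negAut

/-- **THEOREM (UNCONDITIONAL): `θ_g(p) = 0` for every `p ≤ p_c` at every vertex of `Cay(H₃(ℤ) × ℤ/2; a, b, ab·e, ba·e)`** — a Cayley graph of the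
virtually-Heisenberg group `H₃(ℤ) × ℤ/2` reached only through the class-2 connected-cylinder theorem (`core_ne_top`, diagonal letters under every
chart). builds on p205010 (kernel theorem, internal audit signed; external expert review pending). [cite: BenjaminiSchramm1996, Conj. 4; §2] -/
theorem torsion_theta_eq_zero_of_le (g : H3E) {p : unitInterval} (hp : (p : ℝ) ≤ criticalProb (mulCayley (S₈ : Set H3E)) g) :
    theta (mulCayley (S₈ : Set H3E)) g p = 0 :=
  torsion.theta_eq_zero_of_le g hp

/-- **`θ_g(p_c) = 0` on `Cay(H₃(ℤ) × ℤ/2; a, b, ab·e, ba·e)`** (the `p = p_c` case). builds on p205010 (kernel theorem, internal audit signed; external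
expert review pending). [cite: BenjaminiSchramm1996, Conj. 4; §2] -/
theorem torsion_criticalContinuity (g : H3E) : theta (mulCayley (S₈ : Set H3E)) g (criticalProbIOf (mulCayley (S₈ : Set H3E)) g) = 0 :=
  torsion.criticalContinuity g

end H3E

end Summit.CriticalPhenomena.PercolationContinuityZ3.Theorems.Transplant

end
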